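import Summits.HodgeConjecture.HodgeConjecture.Theorems.Ring2WeilCoverageCMFieldCriteria
import HarnessLib

/-!
# Non-split Weil-type components over quartic CM fields at INERT primes of any size (two `decide`s over
# `𝔽_ℓ`), with the odd-prime census rows of `ℚ(ζ₅)`, `ℚ(√-(2+√2))` and the non-Galois field `ℚ(√-(3+√2))`

research route conditional on HC_CM; not a corollary; Q11.4-sentence-2 already refuted in dim ≥ 3.
Cell `pub-hodge-ring2`, seat `ring2-b03` (gen 47); kernel certificates for the Weil-type family-coverage
census `HOME/WEIL-FAMILY-COVERAGE.md` §b03.5 (operator priority5 2026-08-22T11:46:08Z). Gen 46 decided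
the joint anisotropy `haniso` of `mk_prime_mul_ne_splitDiscriminantClassCM` at an inert prime `ℓ` by an
`ℓ⁴`-case `decide` (`ℓ ≤ 7`). §1 proves it GENERICALLY by norms — `Nm(U)² - q·Nm(V)² = G₁X + G₂Y` for
`U = a + bσ`, `V = c + dσ` — from two `ℓ`-case facts: `R = S² + pS + q` has no root mod `ℓ` (`ℓ` inert in
`F`) and `q = Nm σ` is a non-square mod `ℓ` (`σ` a non-square in `𝔽_{ℓ²}`, i.e. `(ℓ)` inert in `E = F(√σ)`),
so every inert prime is in reach (`aniso_of_no_root`, `mk_prime_mul_ne_splitDiscriminantClassCM_of_no_root`;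
irreducibility of the carriers by factor exclusion, `Ring2WeilCoverageCMFieldCriteria`). §3–§5 instances:
`ℚ(ζ₅)` (`ℓ = 19, 29` split; `13, 17, 23, 37` inert), `ℚ(√-(2+√2))` (`ℓ = 31` split; `11, 13, 19, 29, 37`
inert), and the `D₄` field `ℚ(√-(3+√2))` of class number `2` (`ℓ = 5, 11, 13` inert) — the first decided
instances of `cmNormResidueGroup` for a NON-GALOIS CM field. Together with gen 46 (`ℓ = 3, 7` / `3, 5`) every
non-split class `[n]`, `n ≤ 40`, of the census tables whose obstruction set `T([n])` contains a place over an
ODD prime UNRAMIFIED in `E` is now decided in the kernel; the residue (computation-only: PARI + two independent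
codes, census ×3) is the dyadic class `[2]` of `ℚ(ζ₅)` (`n = 2, 8, 10, 18, 22, 32, 40`), `[27] = [3]`, and for
the `D₄` field the classes obstructed only at the ramified places `(√2)`, `(7, √2+3)` or at a prime with one
place split and one inert in `E/F` (`n = 3, 6, 7, 12, 14, 17, 19, 23, 24, 27, 28, 31, 34, 38`).

No named fact, no definition, no `sorry`; nothing about the Hodge conjecture is asserted.
References: [Deligne1982HodgeCycles] §4 p. 30 (1), Cor. 4.2, Lemma 4.6; [Landherr1936HermitianForms]. -/

noncomputable section

set_option linter.dupNamespace false

open Polynomial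

namespace Summit.HodgeConjecture.HodgeConjecture.Ring2.WeilCoverageCM

open Literature.AlgebraicGeometry.Deligne1982
open Literature.AlgebraicGeometry.HodgeTheory (splitDiscriminantClassCM)

/-! ### §1 Joint anisotropy at a prime INERT in `F` and in `E/F`, from two `decide`s over `𝔽_ℓ` -/

/-- **Anisotropy at a prime INERT in `F` with `(ℓ)` INERT in `E/F`**, generic. If `R = S² + pS + q` has no
root mod `ℓ` (`ℓ` inert in `F`, `𝔽_ℓ[σ] = 𝔽_{ℓ²}`) and `q = Nm σ` is a non-square mod `ℓ` (equivalently `σ` is a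
non-square in `𝔽_{ℓ²}`, i.e. `(ℓ)` is inert in `E = F(√σ)`), then the two coordinate forms `X`, `Y` of
`(a + bσ)² - σ(c + dσ)²` vanish mod `ℓ` only at the origin. Proof by norms, with no model of `𝔽_{ℓ²}`: from
`U² = σV²` (`U = a + bσ`, `V = c + dσ`), `Nm(U)² = q·Nm(V)²` — as the identity
`Nm(U)² - q Nm(V)² = G₁X + G₂Y` — so `Nm(V) = c² - pcd + qd² = 0` (else `q` is a square), whence `d = 0`
(else `-c/d` is a root of `R`) and `c = 0`; then `Nm(U)² = 0` likewise gives `a = b = 0`. This replaces the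
`ℓ⁴`-case `decide` of the gen-46 instances by two `ℓ`-case ones, so every inert prime is in reach. [folklore] -/
theorem aniso_of_no_root (p q : ℤ) (ℓ : ℕ) (hℓ : ℓ.Prime)
    (hnr : ∀ k : ZMod ℓ, k ^ 2 + (p : ZMod ℓ) * k + (q : ZMod ℓ) ≠ 0) (hq : ∀ r : ZMod ℓ, r ^ 2 ≠ (q : ZMod ℓ)) :
    ∀ a b c d : ZMod ℓ,
      a ^ 2 - (q : ZMod ℓ) * b ^ 2 + 2 * (q : ZMod ℓ) * c * d - (p : ZMod ℓ) * (q : ZMod ℓ) * d ^ 2 = 0 →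
      2 * a * b - (p : ZMod ℓ) * b ^ 2 - c ^ 2 + 2 * (p : ZMod ℓ) * c * d
          - ((p : ZMod ℓ) ^ 2 - (q : ZMod ℓ)) * d ^ 2 = 0 →
        a = 0 ∧ b = 0 ∧ c = 0 ∧ d = 0 := by
  haveI : Fact ℓ.Prime := ⟨hℓ⟩
  intro a b c d hX hY
  -- `Nm(V) = 0 ⇒ V = 0` (no root of `R` mod `ℓ`)
  have hnormzero : ∀ u v : ZMod ℓ, u ^ 2 - (p : ZMod ℓ) * u * v + (q : ZMod ℓ) * v ^ 2 = 0 → u = 0 ∧ v = 0 := by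
    intro u v h
    by_cases hv : v = 0
    · rw [hv] at h
      have hu : u ^ 2 = 0 := by linear_combination h
      exact ⟨pow_eq_zero_iff (n := 2) (by norm_num) |>.1 hu, hv⟩
    · exfalso
      refine hnr (-u / v) ?_
      field_simp
      linear_combination h
  -- the norm identity `Nm(U)² - q·Nm(V)² = G₁·X + G₂·Y`
  have hN : (a ^ 2 - (p : ZMod ℓ) * a * b + (q : ZMod ℓ) * b ^ 2) ^ 2
      - (q : ZMod ℓ) * (c ^ 2 - (p : ZMod ℓ) * c * d + (q : ZMod ℓ) * d ^ 2) ^ 2 = 0 := by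
    linear_combination
      (2 * (-2 * (q : ZMod ℓ) * c * d + (p : ZMod ℓ) * (q : ZMod ℓ) * d ^ 2)
        - (p : ZMod ℓ) * (c ^ 2 - (q : ZMod ℓ) * d ^ 2 - 2 * (p : ZMod ℓ) * c * d + (p : ZMod ℓ) ^ 2 * d ^ 2)
        + (a ^ 2 - (q : ZMod ℓ) * b ^ 2 + 2 * (q : ZMod ℓ) * c * d - (p : ZMod ℓ) * (q : ZMod ℓ) * d ^ 2)
        - (p : ZMod ℓ) * (2 * a * b - (p : ZMod ℓ) * b ^ 2 - c ^ 2 + 2 * (p : ZMod ℓ) * c * d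
            - ((p : ZMod ℓ) ^ 2 - (q : ZMod ℓ)) * d ^ 2)) * hX
      + (2 * (q : ZMod ℓ) * (c ^ 2 - (q : ZMod ℓ) * d ^ 2 - 2 * (p : ZMod ℓ) * c * d + (p : ZMod ℓ) ^ 2 * d ^ 2)
        - (p : ZMod ℓ) * (-2 * (q : ZMod ℓ) * c * d + (p : ZMod ℓ) * (q : ZMod ℓ) * d ^ 2)
        + (q : ZMod ℓ) * (2 * a * b - (p : ZMod ℓ) * b ^ 2 - c ^ 2 + 2 * (p : ZMod ℓ) * c * d
            - ((p : ZMod ℓ) ^ 2 - (q : ZMod ℓ)) * d ^ 2)) * hY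
  -- `Nm(V) = 0`, else `q` is a square
  have hV : c ^ 2 - (p : ZMod ℓ) * c * d + (q : ZMod ℓ) * d ^ 2 = 0 := by
    by_contra hne
    refine hq ((a ^ 2 - (p : ZMod ℓ) * a * b + (q : ZMod ℓ) * b ^ 2)
      / (c ^ 2 - (p : ZMod ℓ) * c * d + (q : ZMod ℓ) * d ^ 2)) ?_
    rw [div_pow, div_eq_iff (pow_ne_zero 2 hne)]
    linear_combination hN
  obtain ⟨hc, hd⟩ := hnormzero c d hV
  -- with `V = 0`: `Nm(U)² = 0`
  rw [hc, hd] at hN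
  have hU2 : (a ^ 2 - (p : ZMod ℓ) * a * b + (q : ZMod ℓ) * b ^ 2) ^ 2 = 0 := by linear_combination hN
  have hU := pow_eq_zero_iff (n := 2) (by norm_num) |>.1 hU2
  obtain ⟨ha, hb⟩ := hnormzero a b hU
  exact ⟨ha, hb, hc, hd⟩

/-- **Non-split criterion at a prime inert in `F` and in `E/F`** (CM regime `0 < p`, `4q < p²`, `p² - 4q` not a
rational square; `R` without roots and `q` a non-square mod `ℓ`): `[ℓw] ≠ [1]` in `F^×/Nm_{E/F}(E^×)` for
`ℓ ∤ w`. [cite: Deligne1982HodgeCycles, §4 p. 30 (1) and Cor. 4.2] [cite: Landherr1936HermitianForms] -/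
theorem mk_prime_mul_ne_splitDiscriminantClassCM_of_no_root {p q : ℤ} {R : Polynomial ℤ}
    (hR : R = X ^ 2 + C p * X + C q) [Fact (Irreducible (realPolyQ R))]
    (hp : 0 < p) (h4 : 4 * q < p ^ 2) (hD : ∀ r : ℚ, r ^ 2 ≠ (p : ℚ) ^ 2 - 4 * q)
    (ℓ : ℕ) (hℓ : ℓ.Prime) (hnr : ∀ k : ZMod ℓ, k ^ 2 + (p : ZMod ℓ) * k + (q : ZMod ℓ) ≠ 0)
    (hq : ∀ r : ZMod ℓ, r ^ 2 ≠ (q : ZMod ℓ))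
    (w : ℤ) (hw : ¬ (ℓ : ℤ) ∣ w) (u : (realField R)ˣ)
    (hu : (u : realField R) = AdjoinRoot.of (realPolyQ R) (ℓ * w)) :
    (QuotientGroup.mk u : cmNormResidueGroup R) ≠ splitDiscriminantClassCM R 2 := by
  haveI : Fact ℓ.Prime := ⟨hℓ⟩
  haveI : Fact (Irreducible (cmPolyQ R)) := fact_irreducible_cmPolyQ_of_pos hR hp h4 hD
  exact mk_prime_mul_ne_splitDiscriminantClassCM hR ℓ (aniso_of_no_root p q ℓ hℓ hnr hq) w hw u hu

/-! ### §2 Discriminants of the three carriers -/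

/-- `ℚ(ζ₅)`: `5² - 4·5 = 5` is not a rational square. [folklore] -/
theorem disc_not_sq_five_five : ∀ r : ℚ, r ^ 2 ≠ ((5 : ℤ) : ℚ) ^ 2 - 4 * ((5 : ℤ) : ℚ) := fun r h =>
  rat_sq_ne_prime_mul_sq (by norm_num : Nat.Prime 5) (m := 1) (by norm_num) r (by rw [h]; norm_num)

/-- `ℚ(√-(2+√2))`: `4² - 4·2 = 8 = 2·2²` is not a rational square. [folklore] -/
theorem disc_not_sq_four_two : ∀ r : ℚ, r ^ 2 ≠ ((4 : ℤ) : ℚ) ^ 2 - 4 * ((2 : ℤ) : ℚ) := fun r h =>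
  rat_sq_ne_prime_mul_sq Nat.prime_two (m := 2) (by norm_num) r (by rw [h]; norm_num)

/-- `ℚ(√-(3+√2))`: `6² - 4·7 = 8 = 2·2²` is not a rational square. [folklore] -/
theorem disc_not_sq_six_seven : ∀ r : ℚ, r ^ 2 ≠ ((6 : ℤ) : ℚ) ^ 2 - 4 * ((7 : ℤ) : ℚ) := fun r h =>
  rat_sq_ne_prime_mul_sq Nat.prime_two (m := 2) (by norm_num) r (by rw [h]; norm_num)

/-! ### §3 `E = ℚ(ζ₅)`: `R = S² + 5S + 5`, `F = ℚ(√5)` — every ODD obstruction (`T(δ) ∋` a place over an odd prime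
`ℓ ≤ 40`): `ℓ = 19, 29` split in `F`, `ℓ = 13, 17, 23, 37` inert (`ℓ = 3, 7`: gen 46) -/

/-- **`[19w] ≠ [1]` for `E = ℚ(ζ₅)`, `19 ∤ w`** (`19` SPLIT in `F`: `σ ≡ 2, 12 mod 19`, both non-squares,
i.e. both places over `19` inert in `E/F`): census rows `[19]`, `[38]` (`T = {(19, √5−10), (19, √5−9)}`). [cite: Deligne1982HodgeCycles, §4 p. 30 (1) and Cor. 4.2] -/
theorem zeta5_mk_nineteen_mul_ne_splitDiscriminantClassCM {R : Polynomial ℤ}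
    (hR : R = X ^ 2 + C 5 * X + C 5) [Fact (Irreducible (realPolyQ R))] (w : ℤ) (hw : ¬ (19 : ℤ) ∣ w)
    (u : (realField R)ˣ) (hu : (u : realField R) = AdjoinRoot.of (realPolyQ R) (19 * w)) :
    (QuotientGroup.mk u : cmNormResidueGroup R) ≠ splitDiscriminantClassCM R 2 :=
  mk_prime_mul_ne_splitDiscriminantClassCM_of_two_roots hR (by norm_num) (by norm_num)
    disc_not_sq_five_five 19 (by norm_num) 2 12 (by decide) (by decide) (by decide) (by decide) (by decide) w hw u
    (by rw [hu]; push_cast; ring_nf)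

/-- **`[29w] ≠ [1]` for `E = ℚ(ζ₅)`, `29 ∤ w`** (`29` SPLIT in `F`: `σ ≡ 3, 21 mod 29`, both non-squares,
i.e. both places over `29` inert in `E/F`): census rows `[29]` (both places over `29`). [cite: Deligne1982HodgeCycles, §4 p. 30 (1) and Cor. 4.2] -/
theorem zeta5_mk_twentyNine_mul_ne_splitDiscriminantClassCM {R : Polynomial ℤ}
    (hR : R = X ^ 2 + C 5 * X + C 5) [Fact (Irreducible (realPolyQ R))] (w : ℤ) (hw : ¬ (29 : ℤ) ∣ w)
    (u : (realField R)ˣ) (hu : (u : realField R) = AdjoinRoot.of (realPolyQ R) (29 * w)) :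
    (QuotientGroup.mk u : cmNormResidueGroup R) ≠ splitDiscriminantClassCM R 2 :=
  mk_prime_mul_ne_splitDiscriminantClassCM_of_two_roots hR (by norm_num) (by norm_num)
    disc_not_sq_five_five 29 (by norm_num) 3 21 (by decide) (by decide) (by decide) (by decide) (by decide) w hw u
    (by rw [hu]; push_cast; ring_nf)

/-- **`[13w] ≠ [1]` for `E = ℚ(ζ₅)`, `13 ∤ w`** (`13` INERT in `F` and `(13)` inert in `E/F`: `5` is a non-square mod `13`, so `R` has no root and `Nm σ = 5` is a non-square):
census rows `[13]`, `[26]`, `[39]`. [cite: Deligne1982HodgeCycles, §4 p. 30 (1) and Cor. 4.2] -/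
theorem zeta5_mk_thirteen_mul_ne_splitDiscriminantClassCM {R : Polynomial ℤ}
    (hR : R = X ^ 2 + C 5 * X + C 5) [Fact (Irreducible (realPolyQ R))] (w : ℤ) (hw : ¬ (13 : ℤ) ∣ w)
    (u : (realField R)ˣ) (hu : (u : realField R) = AdjoinRoot.of (realPolyQ R) (13 * w)) :
    (QuotientGroup.mk u : cmNormResidueGroup R) ≠ splitDiscriminantClassCM R 2 :=
  mk_prime_mul_ne_splitDiscriminantClassCM_of_no_root hR (by norm_num) (by norm_num)
    disc_not_sq_five_five 13 (by norm_num) (by decide) (by decide) w hw u (by rw [hu]; push_cast; ring_nf)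

/-- **`[17w] ≠ [1]` for `E = ℚ(ζ₅)`, `17 ∤ w`** (`17` INERT in `F` and `(17)` inert in `E/F`: `5` is a non-square mod `17`, so `R` has no root and `Nm σ = 5` is a non-square):
census rows `[17]`, `[34]`. [cite: Deligne1982HodgeCycles, §4 p. 30 (1) and Cor. 4.2] -/
theorem zeta5_mk_seventeen_mul_ne_splitDiscriminantClassCM {R : Polynomial ℤ}
    (hR : R = X ^ 2 + C 5 * X + C 5) [Fact (Irreducible (realPolyQ R))] (w : ℤ) (hw : ¬ (17 : ℤ) ∣ w)
    (u : (realField R)ˣ) (hu : (u : realField R) = AdjoinRoot.of (realPolyQ R) (17 * w)) :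
    (QuotientGroup.mk u : cmNormResidueGroup R) ≠ splitDiscriminantClassCM R 2 :=
  mk_prime_mul_ne_splitDiscriminantClassCM_of_no_root hR (by norm_num) (by norm_num)
    disc_not_sq_five_five 17 (by norm_num) (by decide) (by decide) w hw u (by rw [hu]; push_cast; ring_nf)

/-- **`[23w] ≠ [1]` for `E = ℚ(ζ₅)`, `23 ∤ w`** (`23` INERT in `F` and `(23)` inert in `E/F`: `5` is a non-square mod `23`, so `R` has no root and `Nm σ = 5` is a non-square):
census rows `[23]`. [cite: Deligne1982HodgeCycles, §4 p. 30 (1) and Cor. 4.2] -/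
theorem zeta5_mk_twentyThree_mul_ne_splitDiscriminantClassCM {R : Polynomial ℤ}
    (hR : R = X ^ 2 + C 5 * X + C 5) [Fact (Irreducible (realPolyQ R))] (w : ℤ) (hw : ¬ (23 : ℤ) ∣ w)
    (u : (realField R)ˣ) (hu : (u : realField R) = AdjoinRoot.of (realPolyQ R) (23 * w)) :
    (QuotientGroup.mk u : cmNormResidueGroup R) ≠ splitDiscriminantClassCM R 2 :=
  mk_prime_mul_ne_splitDiscriminantClassCM_of_no_root hR (by norm_num) (by norm_num)
    disc_not_sq_five_five 23 (by norm_num) (by decide) (by decide) w hw u (by rw [hu]; push_cast; ring_nf)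

/-- **`[37w] ≠ [1]` for `E = ℚ(ζ₅)`, `37 ∤ w`** (`37` INERT in `F` and `(37)` inert in `E/F`: `5` is a non-square mod `37`, so `R` has no root and `Nm σ = 5` is a non-square):
census rows `[37]`. [cite: Deligne1982HodgeCycles, §4 p. 30 (1) and Cor. 4.2] -/
theorem zeta5_mk_thirtySeven_mul_ne_splitDiscriminantClassCM {R : Polynomial ℤ}
    (hR : R = X ^ 2 + C 5 * X + C 5) [Fact (Irreducible (realPolyQ R))] (w : ℤ) (hw : ¬ (37 : ℤ) ∣ w)
    (u : (realField R)ˣ) (hu : (u : realField R) = AdjoinRoot.of (realPolyQ R) (37 * w)) :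
    (QuotientGroup.mk u : cmNormResidueGroup R) ≠ splitDiscriminantClassCM R 2 :=
  mk_prime_mul_ne_splitDiscriminantClassCM_of_no_root hR (by norm_num) (by norm_num)
    disc_not_sq_five_five 37 (by norm_num) (by decide) (by decide) w hw u (by rw [hu]; push_cast; ring_nf)

/-! ### §4 `E = ℚ(√-(2+√2))` (`⊂ ℚ(ζ₁₆)`): `R = S² + 4S + 2`, `F = ℚ(√2)` — `ℓ = 31` split, `ℓ = 11, 13, 19, 29, 37` inert
(`2` a non-square mod `ℓ ≡ ±3 (8)`; `ℓ = 3, 5`: gen 46) -/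

/-- **`[31w] ≠ [1]` for `E = ℚ(√-(2+√2))`, `31 ∤ w`** (`31` SPLIT in `F`: `σ ≡ 21, 6 mod 31`, both non-squares,
i.e. both places over `31` inert in `E/F`): census rows `[31]` (`T = {(31, √2−8), (31, √2+8)}`). [cite: Deligne1982HodgeCycles, §4 p. 30 (1) and Cor. 4.2] -/
theorem sqrtNegTwoPlusSqrtTwo_mk_thirtyOne_mul_ne_splitDiscriminantClassCM {R : Polynomial ℤ}
    (hR : R = X ^ 2 + C 4 * X + C 2) [Fact (Irreducible (realPolyQ R))] (w : ℤ) (hw : ¬ (31 : ℤ) ∣ w)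
    (u : (realField R)ˣ) (hu : (u : realField R) = AdjoinRoot.of (realPolyQ R) (31 * w)) :
    (QuotientGroup.mk u : cmNormResidueGroup R) ≠ splitDiscriminantClassCM R 2 :=
  mk_prime_mul_ne_splitDiscriminantClassCM_of_two_roots hR (by norm_num) (by norm_num)
    disc_not_sq_four_two 31 (by norm_num) 21 6 (by decide) (by decide) (by decide) (by decide) (by decide) w hw u
    (by rw [hu]; push_cast; ring_nf)

/-- **`[11w] ≠ [1]` for `E = ℚ(√-(2+√2))`, `11 ∤ w`** (`11` INERT in `F` and `(11)` inert in `E/F`: `2` is a non-square mod `11`, so `R` (discriminant `8`) has no root and `Nm σ = 2` is a non-square):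
census rows `[11]`, `[22]`, `[33]`. [cite: Deligne1982HodgeCycles, §4 p. 30 (1) and Cor. 4.2] -/
theorem sqrtNegTwoPlusSqrtTwo_mk_eleven_mul_ne_splitDiscriminantClassCM {R : Polynomial ℤ}
    (hR : R = X ^ 2 + C 4 * X + C 2) [Fact (Irreducible (realPolyQ R))] (w : ℤ) (hw : ¬ (11 : ℤ) ∣ w)
    (u : (realField R)ˣ) (hu : (u : realField R) = AdjoinRoot.of (realPolyQ R) (11 * w)) :
    (QuotientGroup.mk u : cmNormResidueGroup R) ≠ splitDiscriminantClassCM R 2 :=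
  mk_prime_mul_ne_splitDiscriminantClassCM_of_no_root hR (by norm_num) (by norm_num)
    disc_not_sq_four_two 11 (by norm_num) (by decide) (by decide) w hw u (by rw [hu]; push_cast; ring_nf)

/-- **`[13w] ≠ [1]` for `E = ℚ(√-(2+√2))`, `13 ∤ w`** (`13` INERT in `F` and `(13)` inert in `E/F`: `2` is a non-square mod `13`, so `R` (discriminant `8`) has no root and `Nm σ = 2` is a non-square):
census rows `[13]`, `[26]`, `[39]`. [cite: Deligne1982HodgeCycles, §4 p. 30 (1) and Cor. 4.2] -/
theorem sqrtNegTwoPlusSqrtTwo_mk_thirteen_mul_ne_splitDiscriminantClassCM {R : Polynomial ℤ}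
    (hR : R = X ^ 2 + C 4 * X + C 2) [Fact (Irreducible (realPolyQ R))] (w : ℤ) (hw : ¬ (13 : ℤ) ∣ w)
    (u : (realField R)ˣ) (hu : (u : realField R) = AdjoinRoot.of (realPolyQ R) (13 * w)) :
    (QuotientGroup.mk u : cmNormResidueGroup R) ≠ splitDiscriminantClassCM R 2 :=
  mk_prime_mul_ne_splitDiscriminantClassCM_of_no_root hR (by norm_num) (by norm_num)
    disc_not_sq_four_two 13 (by norm_num) (by decide) (by decide) w hw u (by rw [hu]; push_cast; ring_nf)

/-- **`[19w] ≠ [1]` for `E = ℚ(√-(2+√2))`, `19 ∤ w`** (`19` INERT in `F` and `(19)` inert in `E/F`: `2` is a non-square mod `19`, so `R` (discriminant `8`) has no root and `Nm σ = 2` is a non-square):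
census rows `[19]`, `[38]`. [cite: Deligne1982HodgeCycles, §4 p. 30 (1) and Cor. 4.2] -/
theorem sqrtNegTwoPlusSqrtTwo_mk_nineteen_mul_ne_splitDiscriminantClassCM {R : Polynomial ℤ}
    (hR : R = X ^ 2 + C 4 * X + C 2) [Fact (Irreducible (realPolyQ R))] (w : ℤ) (hw : ¬ (19 : ℤ) ∣ w)
    (u : (realField R)ˣ) (hu : (u : realField R) = AdjoinRoot.of (realPolyQ R) (19 * w)) :
    (QuotientGroup.mk u : cmNormResidueGroup R) ≠ splitDiscriminantClassCM R 2 :=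
  mk_prime_mul_ne_splitDiscriminantClassCM_of_no_root hR (by norm_num) (by norm_num)
    disc_not_sq_four_two 19 (by norm_num) (by decide) (by decide) w hw u (by rw [hu]; push_cast; ring_nf)

/-- **`[29w] ≠ [1]` for `E = ℚ(√-(2+√2))`, `29 ∤ w`** (`29` INERT in `F` and `(29)` inert in `E/F`: `2` is a non-square mod `29`, so `R` (discriminant `8`) has no root and `Nm σ = 2` is a non-square):
census rows `[29]`. [cite: Deligne1982HodgeCycles, §4 p. 30 (1) and Cor. 4.2] -/
theorem sqrtNegTwoPlusSqrtTwo_mk_twentyNine_mul_ne_splitDiscriminantClassCM {R : Polynomial ℤ}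
    (hR : R = X ^ 2 + C 4 * X + C 2) [Fact (Irreducible (realPolyQ R))] (w : ℤ) (hw : ¬ (29 : ℤ) ∣ w)
    (u : (realField R)ˣ) (hu : (u : realField R) = AdjoinRoot.of (realPolyQ R) (29 * w)) :
    (QuotientGroup.mk u : cmNormResidueGroup R) ≠ splitDiscriminantClassCM R 2 :=
  mk_prime_mul_ne_splitDiscriminantClassCM_of_no_root hR (by norm_num) (by norm_num)
    disc_not_sq_four_two 29 (by norm_num) (by decide) (by decide) w hw u (by rw [hu]; push_cast; ring_nf)

/-- **`[37w] ≠ [1]` for `E = ℚ(√-(2+√2))`, `37 ∤ w`** (`37` INERT in `F` and `(37)` inert in `E/F`: `2` is a non-square mod `37`, so `R` (discriminant `8`) has no root and `Nm σ = 2` is a non-square):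
census rows `[37]`. [cite: Deligne1982HodgeCycles, §4 p. 30 (1) and Cor. 4.2] -/
theorem sqrtNegTwoPlusSqrtTwo_mk_thirtySeven_mul_ne_splitDiscriminantClassCM {R : Polynomial ℤ}
    (hR : R = X ^ 2 + C 4 * X + C 2) [Fact (Irreducible (realPolyQ R))] (w : ℤ) (hw : ¬ (37 : ℤ) ∣ w)
    (u : (realField R)ˣ) (hu : (u : realField R) = AdjoinRoot.of (realPolyQ R) (37 * w)) :
    (QuotientGroup.mk u : cmNormResidueGroup R) ≠ splitDiscriminantClassCM R 2 :=
  mk_prime_mul_ne_splitDiscriminantClassCM_of_no_root hR (by norm_num) (by norm_num)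
    disc_not_sq_four_two 37 (by norm_num) (by decide) (by decide) w hw u (by rw [hu]; push_cast; ring_nf)

/-! ### §5 The non-Galois field `E = ℚ(√-(3+√2))` (`D₄`, class number `2`): `R = S² + 6S + 7`, `F = ℚ(√2)` —
`ℓ = 5, 11, 13` inert in `F` (`ℓ ≡ ±3 (8)`) with `Nm σ = 7` a non-square mod `ℓ`; both carriers irreducible by factor
exclusion (no Eisenstein prime): the first decided instances of `cmNormResidueGroup` for a NON-GALOIS CM field -/

/-- **`[5w] ≠ [1]` for `E = ℚ(√-(3+√2))`, `5 ∤ w`** (`5` INERT in `F` and `(5)` inert in `E/F`: `R` (discriminant `8`) has no root mod `5` and `Nm σ = 7` is a non-square mod `5`):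
census rows `[5]`, `[10]`, `[15]`, `[20]`, `[30]`, `[35]`, `[40]`. [cite: Deligne1982HodgeCycles, §4 p. 30 (1) and Cor. 4.2] -/
theorem sqrtNegThreePlusSqrtTwo_mk_five_mul_ne_splitDiscriminantClassCM {R : Polynomial ℤ}
    (hR : R = X ^ 2 + C 6 * X + C 7) [Fact (Irreducible (realPolyQ R))] (w : ℤ) (hw : ¬ (5 : ℤ) ∣ w)
    (u : (realField R)ˣ) (hu : (u : realField R) = AdjoinRoot.of (realPolyQ R) (5 * w)) :
    (QuotientGroup.mk u : cmNormResidueGroup R) ≠ splitDiscriminantClassCM R 2 :=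
  mk_prime_mul_ne_splitDiscriminantClassCM_of_no_root hR (by norm_num) (by norm_num)
    disc_not_sq_six_seven 5 (by norm_num) (by decide) (by decide) w hw u (by rw [hu]; push_cast; ring_nf)

/-- **`[11w] ≠ [1]` for `E = ℚ(√-(3+√2))`, `11 ∤ w`** (`11` INERT in `F` and `(11)` inert in `E/F`: `R` (discriminant `8`) has no root mod `11` and `Nm σ = 7` is a non-square mod `11`):
census rows `[11]`, `[22]`, `[33]`. [cite: Deligne1982HodgeCycles, §4 p. 30 (1) and Cor. 4.2] -/
theorem sqrtNegThreePlusSqrtTwo_mk_eleven_mul_ne_splitDiscriminantClassCM {R : Polynomial ℤ}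
    (hR : R = X ^ 2 + C 6 * X + C 7) [Fact (Irreducible (realPolyQ R))] (w : ℤ) (hw : ¬ (11 : ℤ) ∣ w)
    (u : (realField R)ˣ) (hu : (u : realField R) = AdjoinRoot.of (realPolyQ R) (11 * w)) :
    (QuotientGroup.mk u : cmNormResidueGroup R) ≠ splitDiscriminantClassCM R 2 :=
  mk_prime_mul_ne_splitDiscriminantClassCM_of_no_root hR (by norm_num) (by norm_num)
    disc_not_sq_six_seven 11 (by norm_num) (by decide) (by decide) w hw u (by rw [hu]; push_cast; ring_nf)

/-- **`[13w] ≠ [1]` for `E = ℚ(√-(3+√2))`, `13 ∤ w`** (`13` INERT in `F` and `(13)` inert in `E/F`: `R` (discriminant `8`) has no root mod `13` and `Nm σ = 7` is a non-square mod `13`):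
census rows `[13]`, `[26]`, `[39]`. [cite: Deligne1982HodgeCycles, §4 p. 30 (1) and Cor. 4.2] -/
theorem sqrtNegThreePlusSqrtTwo_mk_thirteen_mul_ne_splitDiscriminantClassCM {R : Polynomial ℤ}
    (hR : R = X ^ 2 + C 6 * X + C 7) [Fact (Irreducible (realPolyQ R))] (w : ℤ) (hw : ¬ (13 : ℤ) ∣ w)
    (u : (realField R)ˣ) (hu : (u : realField R) = AdjoinRoot.of (realPolyQ R) (13 * w)) :
    (QuotientGroup.mk u : cmNormResidueGroup R) ≠ splitDiscriminantClassCM R 2 :=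
  mk_prime_mul_ne_splitDiscriminantClassCM_of_no_root hR (by norm_num) (by norm_num)
    disc_not_sq_six_seven 13 (by norm_num) (by decide) (by decide) w hw u (by rw [hu]; push_cast; ring_nf)

/-! ### §6 Unconditional packagings (`R` literal; the `Fact` from factor exclusion) -/

/-- **`[5] ≠ [1]` for `ℚ(√-(3+√2))`** with `R = S² + 6S + 7` LITERALLY (least representative `5` of the row
`{(7,√2+3),(5)}`). [cite: Deligne1982HodgeCycles, §4 p. 30 (1) and Cor. 4.2] -/
theorem sqrtNegThreePlusSqrtTwo_five_nonsplit :
    haveI := fact_irreducible_realPolyQ_of_not_sq (R := X ^ 2 + C 6 * X + C 7) rfl disc_not_sq_six_seven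
    ∀ u : (realField (X ^ 2 + C 6 * X + C 7))ˣ, (u : realField (X ^ 2 + C 6 * X + C 7)) = 5 →
      (QuotientGroup.mk u : cmNormResidueGroup (X ^ 2 + C 6 * X + C 7)) ≠
        splitDiscriminantClassCM (X ^ 2 + C 6 * X + C 7) 2 := by
  haveI := fact_irreducible_realPolyQ_of_not_sq (R := X ^ 2 + C 6 * X + C 7) rfl disc_not_sq_six_seven
  exact fun u hu => sqrtNegThreePlusSqrtTwo_mk_five_mul_ne_splitDiscriminantClassCM rfl 1 (by norm_num) u
    (by rw [hu]; simp)

/-- **`[13] ≠ [1]` for `ℚ(ζ₅)`** with `R = S² + 5S + 5` LITERALLY (row `T = {(√5), (13)}` of the census, least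
representative `13`; the `Fact` here from factor exclusion, interchangeable with gen 46's Eisenstein one).
[cite: Deligne1982HodgeCycles, §4 p. 30 (1) and Cor. 4.2] -/
theorem zeta5_thirteen_nonsplit :
    haveI := fact_irreducible_realPolyQ_of_not_sq (R := X ^ 2 + C 5 * X + C 5) rfl disc_not_sq_five_five
    ∀ u : (realField (X ^ 2 + C 5 * X + C 5))ˣ, (u : realField (X ^ 2 + C 5 * X + C 5)) = 13 →
      (QuotientGroup.mk u : cmNormResidueGroup (X ^ 2 + C 5 * X + C 5)) ≠
        splitDiscriminantClassCM (X ^ 2 + C 5 * X + C 5) 2 := by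
  haveI := fact_irreducible_realPolyQ_of_not_sq (R := X ^ 2 + C 5 * X + C 5) rfl disc_not_sq_five_five
  exact fun u hu => zeta5_mk_thirteen_mul_ne_splitDiscriminantClassCM rfl 1 (by norm_num) u (by rw [hu]; simp)

/-- **`[11] ≠ [1]` for `ℚ(√-(2+√2))`** with `R = S² + 4S + 2` LITERALLY (row `T = {(11)}`, outside the census's
`S6` window). [cite: Deligne1982HodgeCycles, §4 p. 30 (1) and Cor. 4.2] -/
theorem sqrtNegTwoPlusSqrtTwo_eleven_nonsplit :
    haveI := fact_irreducible_realPolyQ_of_not_sq (R := X ^ 2 + C 4 * X + C 2) rfl disc_not_sq_four_two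
    ∀ u : (realField (X ^ 2 + C 4 * X + C 2))ˣ, (u : realField (X ^ 2 + C 4 * X + C 2)) = 11 →
      (QuotientGroup.mk u : cmNormResidueGroup (X ^ 2 + C 4 * X + C 2)) ≠
        splitDiscriminantClassCM (X ^ 2 + C 4 * X + C 2) 2 := by
  haveI := fact_irreducible_realPolyQ_of_not_sq (R := X ^ 2 + C 4 * X + C 2) rfl disc_not_sq_four_two
  exact fun u hu => sqrtNegTwoPlusSqrtTwo_mk_eleven_mul_ne_splitDiscriminantClassCM rfl 1 (by norm_num) u
    (by rw [hu]; simp)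

end Summit.HodgeConjecture.HodgeConjecture.Ring2.WeilCoverageCM

end
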